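import Literature.NumberTheory.EllipticCurves.ZpExtensionShapiroSetting
import Literature.NumberTheory.EllipticCurves.CastellaGrossiLeeSkinner2022.HowardDivisibilityAnyClassNumber
import Literature.NumberTheory.EllipticCurves.HeegnerPointsKolyvaginGoodReductionProofs
import Literature.NumberTheory.EllipticCurves.ModularityVersionApProofs
import Literature.NumberTheory.EllipticCurves.BSDConductorProofs
import Literature.NumberTheory.GaloisRepresentations.SplitsCompletelyCriteria
import Literature.NumberTheory.GaloisRepresentations.IntegralGaloisAction
import HarnessLib

/-!
# Castella–Grossi–Lee–Skinner 2022, Theorem 4.1.1 (with Remark 4.1.4, last sentence): the Heegner point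
# Kolyvagin system `κ^{Hg} ∈ 𝐊𝐒(𝐓, 𝓕_Λ, 𝓛_E)` with `κ₁^{Hg} ≠ 0`, for `E/ℚ` over an imaginary quadratic `K` of ANY
# class number, under `E(K)[p] = 0` — ONE cite-only named fact over the tree's `Λ`-adic source setting `S_Λ`

Topic `NumberTheory/EllipticCurves` (cell `pub/bsd-print-x9`, literature seat g33, TRANCHE 5 file B; sequel of
`ZpExtensionShapiroSetting` (A2: `WeierstrassCurve.shapiroSettingTame`, the triple `(𝐓, 𝓕_Λ, 𝓛)` of `E_K` as a term of
lit's `Howard2004.CoeffTowerSetting` over `R = Λ` on the Shapiro diagonal, with Kolyvagin systems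
`CoeffTowerSetting.KolyvaginSystem` = Howard's Def. 1.2.3 in tower form) and of `HowardDivisibilityAnyClassNumber` (lit
g19: the standing hypotheses `Thm413Hypotheses`, the `d(k)`-shifted `α`-stabilised Heegner datum `StabilizedHeegnerData` /
`stabilizedClassLayer` of Rem. 4.1.4, and Thm. 4.1.3 as a fact)).  ONE named fact (`def … : Prop`, D-0014; nothing
asserted; debt +1), the DEFINITIONS with bodies of the objects it is stated with (the finite bad set `S = {v ∣ pN}`, the
prime set `𝓛_E`, the setting `thm411Setting`), and PROVED lemmas: the `(Heeg)`-vacuity `𝓛₁(𝐓) ∖ S = 𝓛₁(𝐓)`,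
`LargePrimes` / `FsAdmissible` / `FsNatural` for the setting, and the corollary `κ.one = Φ′(z)` of the fact given a
`Λ`-action on Kolyvagin systems (x9-p2 g3 17:49:38Z).  WHY A SEPARATE FACT (lit g19 wrote «Thm. 4.1.1 separately: NOT
typed (its content is INSIDE 4.1.3)»): the cell's shared `μ`-crux (`MuInequalityCoherentPair`, STUB A of the x9-p1
LEAD's skeleton) consumes the Kolyvagin system ITSELF — pushed forward along `Λ → S_𝔮` into Howard's Eisenstein
specialisation (`CoeffTowerSetting.Hom.pushforward`) — not the divisibility 4.1.3 it yields over `Λ`.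

F. Castella, G. Grossi, J. Lee, C. Skinner, *On the anticyclotomic Iwasawa theory of rational elliptic curves at
Eisenstein primes*, Invent. Math. **227** (2022) 517–580 = arXiv:2008.02571v2 [CastellaGrossiLeeSkinner2022];
REFEREED / PUBLISHED.  Text of record: the authors' final TeX (cell `b2b/bsd-rank1-residual`, `cgls22-v2final/
Eisenstein.tex`, locators `[TeX Lnnnn]`, published numbering); the store copy `paper:arxiv-2008.02571` is v1 (v1
«Thm. 4.1» = published Thm. 4.1.1).  B. Howard, *The Heegner point Kolyvagin system*, Compositio Math. **140** (2004)
1439–1472 = arXiv:1202.6340 [Howard2004HeegnerKolyvagin] (§2.2–§2.3: `𝐓`, `𝓕_Λ`, `𝓛 = 𝓛₁(𝐓)`, Thm. 2.3.1, Lemma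
2.3.3–2.3.4).  HONEST FRAMING: typed ≠ proved ≠ endorsed; nothing here moves a class; BSD is not proved by any of this.

## The printed statements, verbatim

* **§3.2 standing** [TeX L1253–1258]: "Let `E/ℚ` be an elliptic curve of conductor `N`, let `p ∤ 2N` be a prime of good
  ordinary reduction for `E`, and let `K` be an imaginary quadratic field of discriminant `D_K` prime to `Np`. We assume
  (h1) `E(K)[p] = 0`."  **§4.1 standing** [L2186]: "Let `E`, `p`, and `K` be as in §3.2, and assume in addition that
  hypotheses (Heeg) and (disc) hold" ((Heeg) [L211–212] «every prime `ℓ ∣ N` splits in `K`»; (disc) [L248–249] «`D_K`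
  is odd and `D_K ≠ -3`»).  — the tree's `Thm413Hypotheses N W K p κ γ` (lit g19), field by field.
* **§3.1** [L1225–1246; v1 p0014 L25–33]: Kolyvagin systems `𝐊𝐒(T, 𝓕, 𝓛)` with the finite–singular maps `φ^{fs}_λ` of
  [MR04, Lemma 1.2.1]; «a Selmer triple `(M, 𝓕, 𝓛)` [is] the data of a Selmer structure `𝓕` on `M` and a subset
  `𝓛 ⊂ 𝓛₀` with `𝓛 ∩ Σ(𝓕) = ∅`».  **§3.2** [L1309–1311; v1 p0015 L30–32]: «`𝓛_E := {ℓ ∈ 𝓛₀(T_pE) : a_ℓ ≡ ℓ + 1 ≡ 0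
  (mod p)}`» — Howard's `𝓛₁(T)` (Howard Def. 1.2.1 and [arXiv p0012 L133–139] «`I_ℓ` is generated by `a_ℓ` and `ℓ+1`»;
  §2.3 [arXiv p0018 L65] «Define `𝓛 = 𝓛₁(𝐓)`»).
* **§3.4** [L2083–2108]: «`𝐓 := M_E^∨(1) ≃ T_pE ⊗_{ℤ_p} Λ`, where the `G_K`-action on `Λ` is given by the inverse `Ψ⁻¹`
  of the tautological character `Ψ : G_K ↠ Γ ↪ Λ^×`»; `𝓕_Λ`: at `w ∣ p` the image of `H¹(K_w, Fil⁺_w 𝐓)`, at the other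
  `w ∈ Σ = {w ∣ pN∞}` all of `H¹(K_w, 𝐓)`.
* **Theorem 4.1.1** [L2203–2206]: "Assume `E(K)[p] = 0`. Then there exists a Kolyvagin system
  `κ^{Hg} ∈ 𝐊𝐒(𝐓, 𝓕_Λ, 𝓛_E)` such that `κ₁^{Hg} ∈ H¹_{𝓕_Λ}(K, 𝐓)` is nonzero."  Proof [L2208–2249]: "Under the
  additional hypotheses that `p ∤ h_K` … and … `G_K → Aut_{ℤ_p}(T)` is surjective, this is [How04, Thm. 2.3.1]. … For
  each `n ∈ 𝒩` set `P_k[n] := Norm_{K[np^{d(k)}]/K_k[n]}(P[np^{d(k)}]) ∈ E(K_k[n])`, where `d(k) = min{d ∈ ℤ_{≥0} :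
  K_k ⊂ K[p^{d(k)}]}` … the arguments proving Lemma 2.3.4 (in the case `v ∣ p`) apply almost *verbatim* in the case
  when `p` divides the class number of `K`" [L2245–2247]. "Finally, that `κ₁^{Hg}` is nonzero follows from the works
  of Cornut and Vatsal" [L2247–2249].
* **Remark 4.1.4** [L2262–2294]: the `α`-stabilised Heegner points `P[p^k]_α`, `κ_k = α^{-d(k)} Norm_{K[p^{d(k)}]/K_k}
  (P[p^{d(k)}]_α)`, `κ_∞ := lim←_k δ(κ_k) ∈ lim←_k H¹(K_k, T_pE) ≃ H¹(K, 𝐓)`; last sentence [L2291–2294]: "**In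
  particular, `κ_∞` and `κ₁^{Hg}` generate the same `Λ`-submodule of `H¹_{𝓕_Λ}(K, 𝐓)`.**"

## Transcription (print-exact; the quantified slots are presentation artefacts, see `kolyvaginSystemCongr`)

* `𝐊𝐒(𝐓, 𝓕_Λ, 𝓛_E)` ∋ `κ` is `κ : (thm411Setting …).KolyvaginSystem` — lit's `CoeffTowerSetting.KolyvaginSystem` (Howard
  Def. 1.2.3, tower form: level systems on the canonical quotients `𝐓_j/I_n𝐓_j` with the (ks) relations, compatible
  under the reductions, bottom class `κ.one ∈ lim_j H¹_{𝓕_Λ}(K, 𝐓_j)`) over `thm411Setting` = A2's `shapiroSettingTame`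
  for `E_K` at the twist `κ.unitTwist (-1)` (`Ψ⁻¹`, the convention of x9-p2's `Φ` and of the D1 target), with
  `S = {v ∣ pN}` (`placesDividing`; so `Σ(𝓕_Λ) = ∞ ∪ {v ∣ pN}` and `𝓕_Λ` = A1's `coeffSelmerStructure`: ordinary at
  `v ∣ p`, the propagated `H¹(K_v, 𝐓)` at `v ∣ N`, unramified elsewhere — §3.4 L2102–2108), and
  **`𝓛 = 𝓛_E := 𝓛₁(𝐓) ∖ S`** (`heegnerKolyvaginPrimes`: the tree's `AdicTower.kolyvaginPrimes p 𝐓 1` — Howard's `𝓛₁(𝐓)`,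
  «`ℓ ∈ 𝓛₀`, `p ∣ ℓ+1`, `Frob_λ ≡ 1 mod p`» = «`a_ℓ ≡ ℓ+1 ≡ 0 (mod p)`» — minus `S`, the print's «`𝓛 ∩ Σ(𝓕) = ∅`»
  made explicit; under (Heeg) the removal is VACUOUS: `kolyvaginPrimes_subset_heegnerKolyvaginPrimes`, proved).
* `κ₁^{Hg} ≠ 0` is `κ.one ≠ 0`; «`κ_∞` and `κ₁^{Hg}` generate the same `Λ`-submodule» is the two-sided divisibility
  `(∃ a, κ.one = a • Φ′(z)) ∧ (∃ b, Φ′(z) = b • κ.one)` with `• = AdicTower.smulFamily` (the `Λ`-action on `lim_j H¹(K,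
  𝐓_j)`), where `z ∈ 𝔖 = H¹_{𝓕_Λ}(K, 𝐓)` (`D.S`, `LambdaAdicSelmerData`) IS `κ_∞`: its projection to every layer
  `k > δ` is the stabilised class `δ(κ_k)` (`hz`, lit g19's `stabilizedClassLayer`), and `Φ′ = toShapiroSuccLimitH1`
  is x9-p2's comparison `𝔖 → lim H¹(K, 𝐓_j)` (Howard Def. 2.2.3, the Shapiro identification, in the kernel).  The
  NORMALISED `κ.one = Φ′(z)` is one unit beyond print and is NOT in the fact: it is the proved corollary
  `exists_kolyvaginSystem_one_eq_of_thm411` (given a `Λ`-action on Kolyvagin systems).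
* Universally quantified presentation slots (each either arbitrary in print too or not read by `KolyvaginSystem`;
  A2's `kolyvaginSystemCongr` transports Kolyvagin systems between any two choices of the last three, `one` unchanged):
  the tame pins `π` (Howard Def. 1.1.8 / MR Lemma 1.2.1 fix a generator of `G_ℓ`), the guard `P ⊇ {(n, λ) : λ ∈ n ∈
  𝓝(𝓛)}` of the slots (where alone they are read, and where they ARE Howard's maps: `thm411Setting_fsAdmissible`),
  the conjugation datum `cd`, the residual presentations `πbar`, the H.4 pairing data `Dsrc`.
* PROVENANCE token (cell `pub/bsd-print-x9`, referee question Q-D, REF-113 (A′); an ANNOTATION of how the printed proof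
  runs, not a reliability reservation): `CGLS22-4.1.1@How04-2.3.4-almost-verbatim+CornutVatsal` — at `p ∣ h_K` the
  Kolyvagin system is printed as an «almost verbatim» adaptation of Howard's Lemma 2.3.4 [L2245–2247], and `κ₁^{Hg} ≠ 0`
  is imported from Cornut–Vatsal [L2247–2249].
NOT typed (D-0026; no consumer): Thm. 3.4.1 / Cor. 3.4.2 for an abstract Kolyvagin system; `𝓛_s ⊂ 𝓛_E` (Howard Lemma
2.3.3, CGLS L2214 — here the weaker `LargePrimes` of the setting is PROVED from `𝓛 = 𝓛₁`); anything on `μ`.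

References: [CastellaGrossiLeeSkinner2022] §3.1–§3.4, Thm. 4.1.1, Rem. 4.1.4 (arXiv:2008.02571v2 TeX L1225–1311,
L2083–2108, L2186–2249, L2262–2294); [Howard2004HeegnerKolyvagin] Def. 1.1.8, Def. 1.2.1–1.2.3, §2.2 Def. 2.2.3–2.2.6,
§2.3 Thm. 2.3.1, Lemma 2.3.3–2.3.4 (arXiv:1202.6340 pp. 5–7, p0012, p0016, p0018); [CornutVatsal2007] Thm. 1.5;
[MazurRubinMemoirs2004] Lemma 1.2.1; [SilvermanAEC2009] VII.5.1, VIII; [Marcus2018] Ch. 3 Thm. 21.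
-/

set_option autoImplicit false

noncomputable section

open Function NumberField IsDedekindDomain Field IsLocalRing
open scoped NumberField ContRepresentation TensorProduct Classical

namespace Literature.NumberTheory.EllipticCurves.CastellaGrossiLeeSkinner2022

open WeierstrassCurve Literature.NumberTheory.EllipticCurves Literature.NumberTheory.EllipticCurves.ZpExtension
open Literature.NumberTheory.GaloisRepresentations Literature.NumberTheory.GaloisRepresentations.DiscreteGaloisModule
open Literature.NumberTheory.GaloisCohomology.Howard2004

/-! ## §1 The finite bad set `S = {v ∣ pN}` (`Σ(𝓕_Λ) = ∞ ∪ S`) -/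

section BadSet

variable (K : Type) [Field K] [NumberField K]

/-- **The finite set of places of `K` dividing `n ≠ 0`** (for `n = pN`: `Σ(𝓕_Λ) ∖ ∞ = {w ∣ pN}`), Mathlib's
`Ideal.finite_factors`. [cite: CastellaGrossiLeeSkinner2022, §3.4 (arXiv v2 TeX L2102: Σ = {w ∣ pN∞})] -/
def placesDividing (n : ℕ) (hn : n ≠ 0) : Finset (HeightOneSpectrum (𝓞 K)) :=
  (Ideal.finite_factors (I := Ideal.span {(n : 𝓞 K)})
    (by rw [Ideal.zero_eq_bot, Ne, Ideal.span_singleton_eq_bot]; exact_mod_cast hn)).toFinset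

variable {K}

/-- `v ∣ n` iff `n ∈ v`. [cite: CastellaGrossiLeeSkinner2022, §3.4 (Σ = {w ∣ pN∞})] -/
theorem mem_placesDividing_iff {n : ℕ} (hn : n ≠ 0) (v : HeightOneSpectrum (𝓞 K)) :
    v ∈ placesDividing K n hn ↔ (n : 𝓞 K) ∈ v.asIdeal := by
  rw [placesDividing, Set.Finite.mem_toFinset, Set.mem_setOf_eq, Ideal.dvd_span_singleton]

/-- The places over a divisor `m ∣ n` divide `n` (for `m = p`: `{v ∣ p} ⊆ S`, the hypothesis `hpS` of the setting).
[cite: CastellaGrossiLeeSkinner2022, §3.4 (Σ ∋ w ∣ p)] -/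
theorem mem_placesDividing_of_dvd {m n : ℕ} (hn : n ≠ 0) (hmn : m ∣ n) {v : HeightOneSpectrum (𝓞 K)}
    (hv : (m : 𝓞 K) ∈ v.asIdeal) : v ∈ placesDividing K n hn := by
  obtain ⟨c, rfl⟩ := hmn
  rw [mem_placesDividing_iff, Nat.cast_mul]
  exact v.asIdeal.mul_mem_right _ hv

/-- **Every place of `S = {v ∣ pN}` lies above `p` or above `N`** (`𝔭_v` is prime and `pN ∈ 𝔭_v`) — the hypothesis
`hSN : ∀ v ∈ S, p ∈ v ∨ N ∈ v` of the D1 assembly of STUB A (`Stmt.ksLink`, `h4AtS`, `h5bAtS`: at `v ∈ S ∖ {p}` it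
gives `v ∣ N`, hence `v` split in `K` under (Heeg)). [cite: CastellaGrossiLeeSkinner2022, §3.4 (Σ = {w ∣ pN∞})] -/
theorem natCast_mem_or_natCast_mem_of_mem_placesDividing {p N : ℕ} (hpN : p * N ≠ 0)
    {v : HeightOneSpectrum (𝓞 K)} (hv : v ∈ placesDividing K (p * N) hpN) :
    ((p : ℕ) : 𝓞 K) ∈ v.asIdeal ∨ ((N : ℕ) : 𝓞 K) ∈ v.asIdeal := by
  rw [mem_placesDividing_iff, Nat.cast_mul] at hv
  exact v.isPrime.mem_or_mem hv

/-- **`S = {v ∣ n}` is `Aut(K/ℚ)`-stable**: `σ • v ∣ n ↔ v ∣ n` (`σ` fixes the rational integer `n`, and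
`σ x ∈ 𝔭_{σ v} ↔ x ∈ 𝔭_v`). [cite: CastellaGrossiLeeSkinner2022, §3.4 (Σ = {w ∣ pN∞})] [folklore] -/
theorem smul_mem_placesDividing_iff {n : ℕ} (hn : n ≠ 0) (σ : K ≃ₐ[ℚ] K) (v : HeightOneSpectrum (𝓞 K)) :
    σ • v ∈ placesDividing K n hn ↔ v ∈ placesDividing K n hn := by
  have hσn : σ • ((n : ℕ) : 𝓞 K) = ((n : ℕ) : 𝓞 K) := map_natCast (MulSemiringAction.toRingHom _ (𝓞 K) σ) n
  rw [mem_placesDividing_iff, mem_placesDividing_iff,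
    ← Literature.NumberTheory.Automorphic.HeightOneSpectrum.smul_mem_smul_asIdeal_iff σ v, hσn]

/-- The hypothesis `hSσ : ∀ σ v, σ • v ∈ S → v ∈ S` of the D1 assembly of STUB A, for `S = {v ∣ n}`.
[cite: CastellaGrossiLeeSkinner2022, §3.4 (Σ = {w ∣ pN∞})] [folklore] -/
theorem mem_placesDividing_of_smul_mem {n : ℕ} (hn : n ≠ 0) (σ : K ≃ₐ[ℚ] K) (v : HeightOneSpectrum (𝓞 K))
    (h : σ • v ∈ placesDividing K n hn) : v ∈ placesDividing K n hn :=
  (smul_mem_placesDividing_iff hn σ v).mp h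

/-- **Good reduction of `E_K` off `S = {v ∣ pN}`**, `N` the conductor of `E/ℚ`: the rational prime `ℓ` under `w ∉ S`
does not divide `N` (else `N ∈ w`), so `E` has good reduction at `ℓ` (`ℓ ∣ N_E ↔` bad reduction) and `E_K` at `w`
(base change of good reduction) — the hypothesis `hbad` of the setting.
[cite: SilvermanAEC2009, VII.5 Prop. 5.1(a) and VIII (N_E is divisible exactly by the bad primes)] [cite: CastellaGrossiLeeSkinner2022, §3.2 standing (E of conductor N)] -/
theorem hasGoodReductionAt_of_not_mem_placesDividing (W : WeierstrassCurve ℚ) [W.IsElliptic] {N p : ℕ}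
    (hN : N = W.conductorNorm ℤ) (hpN : p * N ≠ 0) {w : HeightOneSpectrum (𝓞 K)}
    (hw : w ∉ placesDividing K (p * N) hpN) : (W.baseChange K).HasGoodReductionAt w := by
  let v : HeightOneSpectrum (𝓞 ℚ) := w.under (𝓞 ℚ)
  let q : Nat.Primes := Rat.HeightOneSpectrum.primesEquiv v
  have hℓ : (q : ℕ).Prime := q.2
  -- `ℓ = q ∈ v`, hence `ℓ ∈ w`
  have hℓv : ((q : ℕ) : 𝓞 ℚ) ∈ v.asIdeal :=
    (natCast_mem_asIdeal_iff_eq_primesEquiv_symm v hℓ).mpr (Equiv.symm_apply_apply _ v).symm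
  have hℓw : ((q : ℕ) : 𝓞 K) ∈ w.asIdeal := by
    have h : algebraMap (𝓞 ℚ) (𝓞 K) ((q : ℕ) : 𝓞 ℚ) ∈ w.asIdeal := Ideal.mem_comap.mp hℓv
    rwa [map_natCast] at h
  -- `ℓ ∤ N`: otherwise `pN ∈ w`, i.e. `w ∈ S`
  have hℓN : ¬ (q : ℕ) ∣ W.conductorNorm ℤ := fun hd ↦ hw <| by
    rw [← hN] at hd
    exact mem_placesDividing_of_dvd hpN (hd.trans (dvd_mul_left N p)) hℓw
  have hgood : W.HasGoodReductionAt v := by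
    by_contra hbad
    exact hℓN ((W.dvd_conductorNorm_iff v).mpr hbad)
  haveI : w.asIdeal.LiesOver v.asIdeal := ⟨rfl⟩
  exact hasGoodReductionAt_baseChange_of_hasGoodReductionAt_rat W v w hgood

/-- **Under (Heeg) no place over `N` has residue degree two** (`K` imaginary quadratic): a prime `ℓ ∣ N` splits in
`K`, so every `v ∣ ℓ` has `#k_v = ℓ ≠ ℓ²`. [cite: CastellaGrossiLeeSkinner2022, §1 (Heeg) (arXiv v2 TeX L211–212)] [cite: Marcus2018, Ch. 3 Thm. 21] -/
theorem not_isDegreeTwo_of_natCast_mem (hK : IsImaginaryQuadratic K) {N : ℕ} (hHeeg : SatisfiesHeegnerHypothesis N K)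
    {v : HeightOneSpectrum (𝓞 K)} (hNv : (N : 𝓞 K) ∈ v.asIdeal) : ¬ IsDegreeTwo v := by
  haveI : Finite (𝓞 K ⧸ v.asIdeal) := v.asIdeal.finiteQuotientOfFreeOfNeBot v.ne_bot
  letI : Field (𝓞 K ⧸ v.asIdeal) := Ideal.Quotient.field _
  have hℓ : (residueChar v).Prime := by
    unfold residueChar; exact CharP.char_is_prime (𝓞 K ⧸ v.asIdeal) _
  -- the residue characteristic `ℓ` of `v` divides `N` and lies in `v`
  have hℓN : residueChar v ∣ N := by
    refine (ringChar.spec (𝓞 K ⧸ v.asIdeal) N).mp ?_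
    rw [← map_natCast (Ideal.Quotient.mk v.asIdeal), Ideal.Quotient.eq_zero_iff_mem]
    exact hNv
  have hℓv : ((residueChar v : ℕ) : 𝓞 K) ∈ v.asIdeal := by
    rw [← Ideal.Quotient.eq_zero_iff_mem, map_natCast]
    exact (ringChar.spec (𝓞 K ⧸ v.asIdeal) _).mpr dvd_rfl
  intro h2
  have hsplit := splitsCompletely_of_ncard_primesOver_eq_two hK.1 hℓ (hHeeg _ hℓ hℓN)
  have hcard : v.residueCard = residueChar v := hsplit.2 v hℓv
  rw [HeightOneSpectrum.residueCard_eq_card_quotient, h2, sq] at hcard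
  have h1 : residueChar v = 1 := Nat.eq_of_mul_eq_mul_left hℓ.pos (hcard.trans (mul_one _).symm)
  exact hℓ.one_lt.ne' h1

end BadSet

/-! ## §2 The prime set `𝓛_E = 𝓛₁(𝐓) ∖ S` and the (Heeg)-vacuity of `∖ S` -/

section Primes

variable {K : Type} [Field K] [NumberField K] (W : WeierstrassCurve ℚ) [W.IsElliptic] {p : ℕ} [hp : Fact p.Prime]
  (κ₀ : ZpExtension K p) (S : Finset (HeightOneSpectrum (𝓞 K)))

/-- **`𝓛_E := 𝓛₁(𝐓) ∖ S`**: Howard's `𝓛₁(𝐓)` — the tree's `AdicTower.kolyvaginPrimes p 𝐓 1` of the (shifted Shapiro)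
`Λ`-adic tower of `E_K` («`ℓ ∈ 𝓛₀(𝐓)`, `p ∣ ℓ + 1`, `Frob_λ ≡ 1` on `𝐓/p𝐓`» = CGLS's «`a_ℓ ≡ ℓ + 1 ≡ 0 (mod p)`») — with
the print's «`𝓛 ∩ Σ(𝓕) = ∅`» made explicit (vacuous under (Heeg): `kolyvaginPrimes_subset_heegnerKolyvaginPrimes`).
[cite: CastellaGrossiLeeSkinner2022, §3.1–§3.2 (arXiv v2 TeX L1237–1246, L1309–1311: 𝓛 ⊂ 𝓛₀, 𝓛 ∩ Σ = ∅, 𝓛_E)] [cite: Howard2004HeegnerKolyvagin, Def. 1.2.1 and §2.3 (arXiv p0012 L133–139, p0018 L65: 𝓛 = 𝓛₁(𝐓))] -/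
def heegnerKolyvaginPrimes : Set (HeightOneSpectrum (𝓞 K)) :=
  {v | v ∈ (W.shapiroTower K p κ₀).kolyvaginPrimes p 1 ∧ v ∉ S}

/-- `𝓛_E ⊆ 𝓛₀(𝐓)` (the hypothesis `hL` of the setting). [cite: CastellaGrossiLeeSkinner2022, §3.1 (𝓛 ⊂ 𝓛₀)] -/
theorem heegnerKolyvaginPrimes_subset_degreeTwoPrimes :
    heegnerKolyvaginPrimes W κ₀ S ⊆ (W.shapiroTower K p κ₀).degreeTwoPrimes p := fun _ hv ↦ hv.1.1

/-- `𝓛_E ∩ S = ∅` (the hypothesis `hLS` of the setting). [cite: CastellaGrossiLeeSkinner2022, §3.1 (𝓛 ∩ Σ(𝓕) = ∅)] -/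
theorem not_mem_of_mem_heegnerKolyvaginPrimes {v : HeightOneSpectrum (𝓞 K)} (hv : v ∈ heegnerKolyvaginPrimes W κ₀ S) :
    v ∉ S := hv.2

/-- `𝓛_E ⊆ 𝓛₁(𝐓)`. [cite: Howard2004HeegnerKolyvagin, §2.3 (𝓛 = 𝓛₁(𝐓))] -/
theorem heegnerKolyvaginPrimes_subset_kolyvaginPrimes :
    heegnerKolyvaginPrimes W κ₀ S ⊆ (W.shapiroTower K p κ₀).kolyvaginPrimes p 1 := fun _ hv ↦ hv.1

/-- **The removal of `S = {v ∣ pN}` from `𝓛₁(𝐓)` is VACUOUS under (Heeg)**: a prime of `𝓛₁(𝐓) ⊆ 𝓛₀(𝐓)` is prime to `p` and of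
degree two, while a place over `N` has degree one (`not_isDegreeTwo_of_natCast_mem`); so `𝓛_E = 𝓛₁(𝐓)`.
[cite: CastellaGrossiLeeSkinner2022, §1 (Heeg), §3.1–§3.2 (𝓛₀: inert primes ℓ ≠ p; 𝓛_E)] [cite: Howard2004HeegnerKolyvagin, §1.2 (𝓛₀) and §2.3] -/
theorem kolyvaginPrimes_subset_heegnerKolyvaginPrimes (hK : IsImaginaryQuadratic K) {N : ℕ}
    (hHeeg : SatisfiesHeegnerHypothesis N K) (hpN : p * N ≠ 0) :
    (W.shapiroTower K p κ₀).kolyvaginPrimes p 1 ⊆ heegnerKolyvaginPrimes W κ₀ (placesDividing K (p * N) hpN) := by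
  intro v hv
  refine ⟨hv, fun hvS ↦ ?_⟩
  have h0 := Set.mem_iInter.mp hv.1 0
  rw [mem_placesDividing_iff, Nat.cast_mul] at hvS
  rcases v.isPrime.mem_or_mem hvS with hpv | hNv
  · exact h0.2.1 hpv
  · exact not_isDegreeTwo_of_natCast_mem hK hHeeg hNv h0.1

/-- Hence `𝓛_E = 𝓛₁(𝐓)` under (Heeg). [cite: CastellaGrossiLeeSkinner2022, §3.2 (𝓛_E)] [cite: Howard2004HeegnerKolyvagin, §2.3 (𝓛 = 𝓛₁(𝐓))] -/
theorem heegnerKolyvaginPrimes_eq_kolyvaginPrimes (hK : IsImaginaryQuadratic K) {N : ℕ}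
    (hHeeg : SatisfiesHeegnerHypothesis N K) (hpN : p * N ≠ 0) :
    heegnerKolyvaginPrimes W κ₀ (placesDividing K (p * N) hpN) = (W.shapiroTower K p κ₀).kolyvaginPrimes p 1 :=
  Set.Subset.antisymm (heegnerKolyvaginPrimes_subset_kolyvaginPrimes W κ₀ _)
    (kolyvaginPrimes_subset_heegnerKolyvaginPrimes W κ₀ hK hHeeg hpN)

end Primes

/-! ## §3 The setting `(𝐓, 𝓕_Λ, 𝓛_E)` of Thm. 4.1.1 and the named fact -/

section Setting

variable {N : ℕ} [NeZero N] {W : WeierstrassCurve ℚ} [W.IsElliptic] [W.IsGloballyMinimal] {K : Type} [Field K]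
  [NumberField K] {p : ℕ} [hp : Fact p.Prime] {κ : ZpExtension K p} {γ : Field.absoluteGaloisGroup K}

omit [NeZero N] [W.IsElliptic] [W.IsGloballyMinimal] in
/-- Bookkeeping: `pN ≠ 0`. [cite: CastellaGrossiLeeSkinner2022, §3.2 standing] -/
theorem mul_level_ne_zero [NeZero N] : p * N ≠ 0 := mul_ne_zero hp.out.ne_zero (NeZero.ne N)

variable (N W K p κ γ) in
/-- **The Selmer triple `(𝐓, 𝓕_Λ, 𝓛_E)` of Thm. 4.1.1 as Howard's tower data** — A2's `shapiroSettingTame` for `E_K` at the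
twist `κ.unitTwist (-1)` (`Ψ⁻¹`), with `S = {v ∣ pN}` (`N` the conductor: `Thm413Hypotheses.level`), `𝓛 = 𝓛_E`, the tame
finite–singular slots with pins `π` and guard `P`, and the caller's slots `jbar, cd, πbar, Dsrc`.  Nothing is asserted
about it. [cite: CastellaGrossiLeeSkinner2022, §3.4 and Thm. 4.1.1 ((𝐓, 𝓕_Λ, 𝓛_E); arXiv v2 TeX L2083–2108, L2203–2206)] [cite: Howard2004HeegnerKolyvagin, §2.2 Def. 2.2.3–2.2.6, §2.3, Def. 1.1.8, Def. 1.2.3] -/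
def thm411Setting (hyp : Thm413Hypotheses N W K p κ γ) (jbar : AlgebraicClosure K →+* ℂ)
    (π : ∀ v : HeightOneSpectrum (𝓞 K), TamePin v)
    (P : Finset (HeightOneSpectrum (𝓞 K)) → HeightOneSpectrum (𝓞 K) → Prop)
    (hP : ∀ j n v, P n v → TameHyp (fun n ↦ W.shapiroLevelQuot (κ.unitTwist (-1)) j n) n v)
    (cd : ConjugationDatum K)
    (πbar : letI := W.shapiroResidueModule K p
      ∀ j, W.ShapiroLevel K p j →ₗ[IwasawaAlgebra p ⧸ shapiroIdeal p (j + 1)] (W.baseChange K).geomTorsion (p : ℤ))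
    (Dsrc : ∀ j, DualityDatum p cd ((W.shapiroTower K p (κ.unitTwist (-1))).ρ j) (IwasawaAlgebra p ⧸ shapiroIdeal p (j + 1))) :
    letI := W.shapiroResidueModule K p
    CoeffTowerSetting p K (IwasawaAlgebra p) (W.ShapiroLevel K p) (fun j ↦ IwasawaAlgebra p ⧸ shapiroIdeal p (j + 1))
      ((W.baseChange K).geomTorsion (p : ℤ))
      (fun j n ↦ LevelData.QuotCarrier (IwasawaAlgebra p ⧸ shapiroIdeal p (j + 1))
        ((W.shapiroTower K p (κ.unitTwist (-1))).ρ j) n) :=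
  W.shapiroSettingTame (κ.unitTwist (-1)) π P hP (placesDividing K (p * N) mul_level_ne_zero)
    (fun _ hv ↦ mem_placesDividing_of_dvd mul_level_ne_zero (dvd_mul_right p N) hv)
    (fun _ hv _ ↦ hasGoodReductionAt_of_not_mem_placesDividing W hyp.level mul_level_ne_zero hv)
    (heegnerKolyvaginPrimes W (κ.unitTwist (-1)) (placesDividing K (p * N) mul_level_ne_zero))
    (heegnerKolyvaginPrimes_subset_degreeTwoPrimes W (κ.unitTwist (-1)) _)
    (fun _ hv ↦ not_mem_of_mem_heegnerKolyvaginPrimes W (κ.unitTwist (-1)) _ hv) jbar cd πbar Dsrc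

variable (hyp : Thm413Hypotheses N W K p κ γ) (jbar : AlgebraicClosure K →+* ℂ)
  (π : ∀ v : HeightOneSpectrum (𝓞 K), TamePin v)
  (P : Finset (HeightOneSpectrum (𝓞 K)) → HeightOneSpectrum (𝓞 K) → Prop)
  (hP : ∀ j n v, P n v → TameHyp (fun n ↦ W.shapiroLevelQuot (κ.unitTwist (-1)) j n) n v)
  (cd : ConjugationDatum K)
  (πbar : letI := W.shapiroResidueModule K p
    ∀ j, W.ShapiroLevel K p j →ₗ[IwasawaAlgebra p ⧸ shapiroIdeal p (j + 1)] (W.baseChange K).geomTorsion (p : ℤ))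
  (Dsrc : ∀ j, DualityDatum p cd ((W.shapiroTower K p (κ.unitTwist (-1))).ρ j) (IwasawaAlgebra p ⧸ shapiroIdeal p (j + 1)))

set_option synthInstance.maxHeartbeats 80000 in
/-- Unfolding: the setting IS A2's `shapiroSettingTame` at `S = {v ∣ pN}`, `𝓛 = 𝓛_E` (so every `shapiroSetting_*` /
`shapiroSettingTame_*` lemma applies). [cite: CastellaGrossiLeeSkinner2022, §3.4] -/
theorem thm411Setting_eq :
    letI := W.shapiroResidueModule K p
    thm411Setting N W K p κ γ hyp jbar π P hP cd πbar Dsrc =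
      W.shapiroSettingTame (κ.unitTwist (-1)) π P hP (placesDividing K (p * N) mul_level_ne_zero)
        (fun _ hv ↦ mem_placesDividing_of_dvd mul_level_ne_zero (dvd_mul_right p N) hv)
        (fun _ hv _ ↦ hasGoodReductionAt_of_not_mem_placesDividing W hyp.level mul_level_ne_zero hv)
        (heegnerKolyvaginPrimes W (κ.unitTwist (-1)) (placesDividing K (p * N) mul_level_ne_zero))
        (heegnerKolyvaginPrimes_subset_degreeTwoPrimes W (κ.unitTwist (-1)) _)
        (fun _ hv ↦ not_mem_of_mem_heegnerKolyvaginPrimes W (κ.unitTwist (-1)) _ hv) jbar cd πbar Dsrc :=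
  rfl

set_option synthInstance.maxHeartbeats 80000 in
/-- The tower of the setting is the shifted Shapiro tower `𝐓_j = E_K[p^{j+1}] ⊗ Λ/(ω_{j+1}, p^{j+1})(Ψ⁻¹)`.
[cite: CastellaGrossiLeeSkinner2022, §3.4 (𝐓 ≃ T_pE ⊗ Λ, Ψ⁻¹)] -/
theorem thm411Setting_T :
    letI := W.shapiroResidueModule K p
    (thm411Setting N W K p κ γ hyp jbar π P hP cd πbar Dsrc).T = W.shapiroTower K p (κ.unitTwist (-1)) :=
  rfl

set_option synthInstance.maxHeartbeats 80000 in
/-- The prime set of the setting is `𝓛_E`. [cite: CastellaGrossiLeeSkinner2022, §3.2 (𝓛_E) and Thm. 4.1.1] -/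
theorem thm411Setting_L :
    letI := W.shapiroResidueModule K p
    (thm411Setting N W K p κ γ hyp jbar π P hP cd πbar Dsrc).L =
      heegnerKolyvaginPrimes W (κ.unitTwist (-1)) (placesDividing K (p * N) mul_level_ne_zero) :=
  rfl

set_option synthInstance.maxHeartbeats 80000 in
/-- `Σ(𝓕_Λ) = ∞ ∪ {v ∣ pN}`. [cite: CastellaGrossiLeeSkinner2022, §3.4 (Σ = {w ∣ pN∞})] -/
theorem thm411Setting_Sigma :
    letI := W.shapiroResidueModule K p
    (thm411Setting N W K p κ γ hyp jbar π P hP cd πbar Dsrc).Sigma =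
      (Finset.univ : Finset (NumberField.InfinitePlace K)).disjSum (placesDividing K (p * N) mul_level_ne_zero) :=
  rfl

set_option synthInstance.maxHeartbeats 80000 in
/-- **`LargePrimes` for the setting** (`𝓛_s(𝐓) ⊆ 𝓛_E` for `s ≥ 1`): `𝓛_E = 𝓛₁(𝐓)` under (Heeg).
[cite: Howard2004HeegnerKolyvagin, §1.6 (arXiv p. 11, L15–16) and §2.3 (𝓛 = 𝓛₁(𝐓))] [cite: CastellaGrossiLeeSkinner2022, §1 (Heeg)] -/
theorem thm411Setting_largePrimes :
    letI := W.shapiroResidueModule K p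
    (thm411Setting N W K p κ γ hyp jbar π P hP cd πbar Dsrc).LargePrimes :=
  W.shapiroSetting_largePrimes (κ.unitTwist (-1)) _ _ _ _ _ _ jbar cd πbar Dsrc _
    (kolyvaginPrimes_subset_heegnerKolyvaginPrimes W (κ.unitTwist (-1)) hyp.isImaginaryQuadratic hyp.heegner
      mul_level_ne_zero)

set_option synthInstance.maxHeartbeats 80000 in
/-- **`FsNatural` for the setting** (any guard). [cite: Howard2004HeegnerKolyvagin, Def. 1.2.3 display (ks relations) and §1.6] -/
theorem thm411Setting_fsNatural :
    letI := W.shapiroResidueModule K p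
    (thm411Setting N W K p κ γ hyp jbar π P hP cd πbar Dsrc).FsNatural :=
  W.shapiroSettingTame_fsNatural (κ.unitTwist (-1)) π P hP _ _ _ _ _ _ jbar cd πbar Dsrc

set_option synthInstance.maxHeartbeats 80000 in
/-- **`FsAdmissible` for the setting** when the guard contains the level pairs `λ ∈ n ∈ 𝓝(𝓛_E)` — there the slots ARE
Howard's / Mazur–Rubin's finite–singular isomorphisms (so the fact below is not weaker than print).
[cite: Howard2004HeegnerKolyvagin, Def. 1.1.8 and Def. 1.2.3] [cite: MazurRubinMemoirs2004, Lemma 1.2.1] -/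
theorem thm411Setting_fsAdmissible
    (hPlev : ∀ n ∈ levels (heegnerKolyvaginPrimes W (κ.unitTwist (-1)) (placesDividing K (p * N) mul_level_ne_zero)),
      ∀ v ∈ n, P n v) :
    letI := W.shapiroResidueModule K p
    (thm411Setting N W K p κ γ hyp jbar π P hP cd πbar Dsrc).FsAdmissible :=
  W.shapiroSettingTame_fsAdmissible (κ.unitTwist (-1)) π P hP _ _ _ _ _ _ jbar cd πbar Dsrc hPlev

/-- **The canonical guard is admissible**: at `λ ∈ n ∈ 𝓝(𝓛_E)` the tame hypotheses hold for `𝐓_j/I_n 𝐓_j` at every `j`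
(A2's `shapiroTameHyp_of_mem_levels`), so `P n v := n ∈ 𝓝(𝓛_E) ∧ v ∈ n` is a legitimate `(P, hP)`.
[cite: Howard2004HeegnerKolyvagin, Def. 1.1.8, Def. 1.2.1–1.2.3 and H.0] -/
theorem tameHyp_of_mem_levels (hyp : Thm413Hypotheses N W K p κ γ) (j : ℕ) (n : Finset (HeightOneSpectrum (𝓞 K)))
    (v : HeightOneSpectrum (𝓞 K))
    (h : n ∈ levels (heegnerKolyvaginPrimes W (κ.unitTwist (-1)) (placesDividing K (p * N) mul_level_ne_zero)) ∧ v ∈ n) :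
    TameHyp (fun n ↦ W.shapiroLevelQuot (κ.unitTwist (-1)) j n) n v :=
  W.shapiroTameHyp_of_mem_levels (κ.unitTwist (-1)) (placesDividing K (p * N) mul_level_ne_zero)
    (fun _ hv ↦ mem_placesDividing_of_dvd mul_level_ne_zero (dvd_mul_right p N) hv)
    (fun _ hv _ ↦ hasGoodReductionAt_of_not_mem_placesDividing W hyp.level mul_level_ne_zero hv)
    (heegnerKolyvaginPrimes W (κ.unitTwist (-1)) (placesDividing K (p * N) mul_level_ne_zero))
    (heegnerKolyvaginPrimes_subset_degreeTwoPrimes W (κ.unitTwist (-1)) _)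
    (fun _ hv ↦ not_mem_of_mem_heegnerKolyvaginPrimes W (κ.unitTwist (-1)) _ hv) j n v h

end Setting

/-! ## §4 Theorem 4.1.1 + Remark 4.1.4 (last sentence) as ONE named fact -/

section Fact

/-- **Castella–Grossi–Lee–Skinner, Invent. Math. 227 (2022), Theorem 4.1.1** (arXiv:2008.02571v2 TeX L2203–2206),
verbatim: "Assume `E(K)[p] = 0`. Then there exists a Kolyvagin system `κ^{Hg} ∈ 𝐊𝐒(𝐓, 𝓕_Λ, 𝓛_E)` such that
`κ₁^{Hg} ∈ H¹_{𝓕_Λ}(K, 𝐓)` is nonzero", **with Remark 4.1.4, last sentence** (L2291–2294): "In particular, `κ_∞` and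
`κ₁^{Hg}` generate the same `Λ`-submodule of `H¹_{𝓕_Λ}(K, 𝐓)`" — under the §3.2 + §4.1 standing hypotheses
(`Thm413Hypotheses`: `E/ℚ` of conductor `N`, `p ∤ 2N` good ordinary, `K` imaginary quadratic with `(D_K, Np) = 1`,
(h1) `E(K)[p] = 0`, (Heeg), (disc), `κ` the anticyclotomic `ℤ_p`-extension, `γ` a topological generator; NO class-number
and NO Galois-image hypothesis).  RECORDED AS: for the Selmer triple `(𝐓, 𝓕_Λ, 𝓛_E)` of `E_K` in Howard's tower form
(`thm411Setting` = A2's `shapiroSettingTame` at the twist `Ψ⁻¹`, `S = {v ∣ pN}`, `𝓛_E = 𝓛₁(𝐓) ∖ S` `= 𝓛₁(𝐓)` under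
(Heeg)), for every `Λ`-adic Selmer datum `D` (`𝔖 = H¹_{𝓕_Λ}(K, 𝐓) ≃ lim← S_p(E/K_k)`), stabilised Heegner datum `C`
(Rem. 4.1.4) and `z ∈ 𝔖` whose projections above the torsion depth are the stabilised classes `δ(κ_k)` (so `z = κ_∞`),
and for every choice of the presentation slots — tame pins `π` (the generator of `G_ℓ` fixed in Def. 1.1.8 / MR Lemma
1.2.1), a guard `P` containing the level pairs `λ ∈ n ∈ 𝓝(𝓛_E)` (where alone the finite–singular slots are read, and
where they ARE Howard's comparison isomorphisms: `thm411Setting_fsAdmissible`), and the record slots `cd`, `πbar`,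
`Dsrc` (not read by `KolyvaginSystem`; A2's `kolyvaginSystemCongr`) —: THERE IS a Kolyvagin system
`κ : (thm411Setting …).KolyvaginSystem` (Howard Def. 1.2.3, tower form) with `κ.one ≠ 0`, and `κ.one`, `Φ′(z)` generate
the same `Λ`-submodule of `lim_j H¹(K, 𝐓_j)` (`∃ a, κ.one = a • Φ′(z)` and `∃ b, Φ′(z) = b • κ.one`, `• = smulFamily`,
`Φ′ = toShapiroSuccLimitH1` x9-p2's Shapiro comparison).  The normalised `κ.one = Φ′(z)` is NOT asserted (corollary
`exists_kolyvaginSystem_one_eq_of_thm411`).  PUBLISHED THEOREM (Invent. math. 227 (2022) 517–580); provenance note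
(ANNOTATION — how the printed proof runs; cell `pub/bsd-print-x9` REF-113 (A′), Q-D):
`CGLS22-4.1.1@How04-2.3.4-almost-verbatim+CornutVatsal` («the arguments proving Lemma 2.3.4 (in the case `v ∣ p`)
apply almost verbatim in the case when `p` divides the class number of `K`» L2245–2247; «that `κ₁^{Hg}` is nonzero
follows from the works of Cornut and Vatsal» L2247–2249).  A `Prop`; nothing asserted.
[cite: CastellaGrossiLeeSkinner2022, Thm. 4.1.1 (arXiv v2 TeX L2203–2249) and Rem. 4.1.4 (L2262–2294); §3.1–§3.4 (𝐊𝐒, 𝓛_E, 𝐓, 𝓕_Λ); §3.2/§4.1 standing hypotheses]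
[cite: Howard2004HeegnerKolyvagin, Thm. 2.3.1, Lemma 2.3.3–2.3.4, Def. 1.2.3, §2.2 Def. 2.2.3–2.2.6 (arXiv:1202.6340 pp. 6–7, p0016, p0018)] -/
def thm411_exists_kolyvaginSystem_one_ne_zero : Prop :=
  ∀ (N : ℕ) [NeZero N] (W : WeierstrassCurve ℚ) [W.IsElliptic] [W.IsGloballyMinimal]
    (K : Type) [Field K] [NumberField K] (p : ℕ) [Fact p.Prime] (κ : ZpExtension K p)
    (γ : Field.absoluteGaloisGroup K) (jbar : AlgebraicClosure K →+* ℂ) (hyp : Thm413Hypotheses N W K p κ γ)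
    (D : (W.baseChange K).LambdaAdicSelmerData κ γ) (C : StabilizedHeegnerData N W K κ jbar) (z : D.S)
    (_hz : ∀ (k : ℕ) (hk : C.depth < k), D.proj k z ∈ stabilizedClassLayer C k hk)
    (π : ∀ v : HeightOneSpectrum (𝓞 K), TamePin v)
    (P : Finset (HeightOneSpectrum (𝓞 K)) → HeightOneSpectrum (𝓞 K) → Prop)
    (hP : ∀ j n v, P n v → TameHyp (fun n ↦ W.shapiroLevelQuot (κ.unitTwist (-1)) j n) n v)
    (_hPlev : ∀ n ∈ levels (heegnerKolyvaginPrimes W (κ.unitTwist (-1)) (placesDividing K (p * N) mul_level_ne_zero)),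
      ∀ v ∈ n, P n v)
    (cd : ConjugationDatum K),
    letI := W.shapiroResidueModule K p
    ∀ (πbar : ∀ j, W.ShapiroLevel K p j →ₗ[IwasawaAlgebra p ⧸ shapiroIdeal p (j + 1)] (W.baseChange K).geomTorsion (p : ℤ))
      (Dsrc : ∀ j, DualityDatum p cd ((W.shapiroTower K p (κ.unitTwist (-1))).ρ j)
        (IwasawaAlgebra p ⧸ shapiroIdeal p (j + 1))),
      ∃ κKS : (thm411Setting N W K p κ γ hyp jbar π P hP cd πbar Dsrc).KolyvaginSystem,
        κKS.one ≠ 0 ∧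
        (∃ a : IwasawaAlgebra p, κKS.one =
          (W.shapiroTower K p (κ.unitTwist (-1))).smulFamily a (W.toShapiroSuccLimitH1 D hyp.topGenerator hyp.noPTorsion z).1) ∧
        (∃ b : IwasawaAlgebra p, (W.toShapiroSuccLimitH1 D hyp.topGenerator hyp.noPTorsion z).1 =
          (W.shapiroTower K p (κ.unitTwist (-1))).smulFamily b κKS.one)

end Fact

/-! ## §5 Kernel bookkeeping: the normalised form `κ.one = Φ′(z)` given a `Λ`-action on Kolyvagin systems -/

section Corollary

variable {N : ℕ} [NeZero N] {W : WeierstrassCurve ℚ} [W.IsElliptic] [W.IsGloballyMinimal] {K : Type} [Field K]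
  [NumberField K] {p : ℕ} [hp : Fact p.Prime] {κ : ZpExtension K p} {γ : Field.absoluteGaloisGroup K}
  {jbar : AlgebraicClosure K →+* ℂ}

omit [NumberField K] in
/-- `a • 0 = 0` for the `Λ`-action on families of classes. [cite: Howard2004HeegnerKolyvagin, §2.2 (𝔖 as a Λ-module)] -/
theorem smulFamily_zero {R : Type} [CommRing R] [IsLocalRing R] {M : ℕ → Type} [∀ k, AddCommGroup (M k)]
    [∀ k, TopologicalSpace (M k)] [∀ k, DiscreteTopology (M k)] [∀ k, Module R (M k)] (T : AdicTower K R M) (a : R) :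
    T.smulFamily a 0 = 0 :=
  funext fun _ ↦ map_zero _

set_option synthInstance.maxHeartbeats 80000 in
/-- **Corollary of the fact (x9-p2 g3 / x9-p1 LEAD: the LINK of STUB A): a Kolyvagin system with `κ.one = Φ′(z)` on the
nose, and `κ.one ≠ 0`**, GIVEN a `Λ`-action `r • κ` on the Kolyvagin systems of the setting with `(r • κ).one = r • κ.one`
(Howard: `𝐊𝐒(𝐓, 𝓕, 𝓛)` is a `Λ`-module; supplied by the consumer): from `Φ′(z) = b • κ.one` take `b • κ`; and `Φ′(z) ≠ 0`
since `κ.one = a • Φ′(z) ≠ 0`. [cite: CastellaGrossiLeeSkinner2022, Thm. 4.1.1 and Rem. 4.1.4 (last sentence)] -/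
theorem exists_kolyvaginSystem_one_eq_of_thm411 (h : thm411_exists_kolyvaginSystem_one_ne_zero)
    (hyp : Thm413Hypotheses N W K p κ γ) (D : (W.baseChange K).LambdaAdicSelmerData κ γ)
    (C : StabilizedHeegnerData N W K κ jbar) (z : D.S)
    (hz : ∀ (k : ℕ) (hk : C.depth < k), D.proj k z ∈ stabilizedClassLayer C k hk)
    (π : ∀ v : HeightOneSpectrum (𝓞 K), TamePin v)
    (P : Finset (HeightOneSpectrum (𝓞 K)) → HeightOneSpectrum (𝓞 K) → Prop)
    (hP : ∀ j n v, P n v → TameHyp (fun n ↦ W.shapiroLevelQuot (κ.unitTwist (-1)) j n) n v)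
    (hPlev : ∀ n ∈ levels (heegnerKolyvaginPrimes W (κ.unitTwist (-1)) (placesDividing K (p * N) mul_level_ne_zero)),
      ∀ v ∈ n, P n v)
    (cd : ConjugationDatum K)
    (πbar : letI := W.shapiroResidueModule K p
      ∀ j, W.ShapiroLevel K p j →ₗ[IwasawaAlgebra p ⧸ shapiroIdeal p (j + 1)] (W.baseChange K).geomTorsion (p : ℤ))
    (Dsrc : ∀ j, DualityDatum p cd ((W.shapiroTower K p (κ.unitTwist (-1))).ρ j) (IwasawaAlgebra p ⧸ shapiroIdeal p (j + 1)))
    (smulKS : letI := W.shapiroResidueModule K p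
      IwasawaAlgebra p → (thm411Setting N W K p κ γ hyp jbar π P hP cd πbar Dsrc).KolyvaginSystem →
        (thm411Setting N W K p κ γ hyp jbar π P hP cd πbar Dsrc).KolyvaginSystem)
    (smulKS_one : letI := W.shapiroResidueModule K p
      ∀ (r : IwasawaAlgebra p) (κKS : (thm411Setting N W K p κ γ hyp jbar π P hP cd πbar Dsrc).KolyvaginSystem),
        (smulKS r κKS).one = (W.shapiroTower K p (κ.unitTwist (-1))).smulFamily r κKS.one) :
    letI := W.shapiroResidueModule K p
    ∃ κKS : (thm411Setting N W K p κ γ hyp jbar π P hP cd πbar Dsrc).KolyvaginSystem,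
      κKS.one = (W.toShapiroSuccLimitH1 D hyp.topGenerator hyp.noPTorsion z).1 ∧ κKS.one ≠ 0 := by
  letI := W.shapiroResidueModule K p
  obtain ⟨κ₀, hne, ⟨a, ha⟩, ⟨b, hb⟩⟩ := h N W K p κ γ jbar hyp D C z hz π P hP hPlev cd πbar Dsrc
  refine ⟨smulKS b κ₀, (smulKS_one b κ₀).trans hb.symm, fun h0 ↦ hne ?_⟩
  have hz0 : (W.toShapiroSuccLimitH1 D hyp.topGenerator hyp.noPTorsion z).1 = 0 :=
    hb.trans ((smulKS_one b κ₀).symm.trans h0)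
  refine ha.trans ?_
  rw [hz0]
  exact smulFamily_zero _ a

end Corollary

end Literature.NumberTheory.EllipticCurves.CastellaGrossiLeeSkinner2022

end
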